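import Summits.ResolutionOfSingularities.ResolutionOfSingularities.Theorems.FrobeniusClosingSteerEvenResidueSigmaChart
import Summits.ResolutionOfSingularities.ResolutionOfSingularities.Theorems.FrobeniusClosingSteerMaxOrderUnique
import Summits.ResolutionOfSingularities.ResolutionOfSingularities.Theorems.FrobeniusClosingSteerEvenResidueSqForm
import Summits.ResolutionOfSingularities.ResolutionOfSingularities.Theorems.FrobeniusClosingSteerShadowVacuous
import Summits.ResolutionOfSingularities.ResolutionOfSingularities.Theorems.FrobeniusClosingSteerStrippedThreadLemmas
import HarnessLib

/-!
# Crux `Steer` (stmt-ResolutionOfSingularities-16345), chain W4.1 — E-ROW row 9 (R3) `EvenResidueLettersHeavyTwoN` PROVED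

OURS (campaign `res-hironaka`, rung L ★L-G4, slot W4.1; seat res-L0-w41-stub-3 g8, res-L0-w41-plan-1 RULING 266 (e) «stub-3 → (R3) kernel»). The word (R3)
CENTRING is res-L0-w41-idea-2 g13's, VERBATIM from `L/res-L0-w41-idea-2/g13/Sketch-hev-rigidity-v1_2.lean` 0f27a225a87339b2 §4 (tri-1 WORD-CHECK 19:09:59Z);
kernel route = idea-2's `g13/R3-PROOF-MAP.md` eab63904c0a3ca30 ((U) → (O) → (T) → (P)), with (O) in the log-derivation variant. Replaces the role of no printed
item; NOT a statement of the manuscript under review [claim: Hironaka2017, status: under-review]; AI-produced, weaker than expert review; counted 0.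

KERNEL PROOF (`evenResidueLettersHeavyTwoN_holds`). Suppose the letter `σ` is NOT heavy at the point step `i`: then `σ` has maximal value on `𝔪ᵢ` (it is an
exceptional parameter). (R1-loc′) `EvenResidueSqForm.evenResidueSqFormLocal_holds` gives `N := sᵢ² − g′² = σ·τ·c² + H`; the STRIPS between `i` and `i'` do not
change the member (`StrippedThread.eq_locAtCentre_of_divisorStep`: `R i' = R (i+1)`); (T)+(O) `EvenResidueSigmaChart.exists_transform_not_sub_sq_mem_pow` gives
`N = σ^(2e)·F`, `F ∈ R i'`, with NO `h`, `F − h² ∈ 𝔪_{i'}^(2e)`; but `z := (sᵢ − g′)/σ^e` has `z² = F`, so (U) `MaxOrder.mem_closure_insert_of_sq_mem` (normality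
`MaxVacuity.normalAt_of_pointStep_along_run` + (N5) `MaxVacuity.memberFrobeniusCongruence_two` at `i'`) writes `z = α + β·s_{i'}`, and the hypothesis at `i'`
(`BinaryResiduePointStepAt … (2e) i'`: some `h` with `s_{i'}² − h² ∈ 𝔪_{i'}^(2e)`) yields `F − (α + β h)² = β²(s_{i'}² − h²) ∈ 𝔪_{i'}^(2e)` — contradiction.
Same for `τ` (the pair `(τ, σ)` is again an rsop pair). [cite: Matsumura1987, Thm. 14.2, Thm. 17.10, Thm. 20.3] [folklore]
bears_on: LADDER-RESOLUTION L ★L-G4 W4.1 (crux `Steer`, (MAX-ND)ᴵ rigidity, E-ROW row 9 (R3)).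
-/

noncomputable section

set_option linter.dupNamespace false
set_option autoImplicit false

open IsLocalRing
open Literature.AlgebraicGeometry.Resolution
open Summit.ResolutionOfSingularities.ResolutionOfSingularities.Theorems.SwitchingDichotomy.Words
open Summit.ResolutionOfSingularities.ResolutionOfSingularities.Theorems.SteerRankThinness (Concl HasProperCoarsening)
open Summit.ResolutionOfSingularities.ResolutionOfSingularities.Theorems.SwitchingDichotomy.ArithReduction
open Summit.ResolutionOfSingularities.ResolutionOfSingularities.Theorems.SwitchingDichotomy

namespace Summit.ResolutionOfSingularities.ResolutionOfSingularities.Theorems.SwitchingDichotomy.HevLeaf.EvenResidueLettersHeavy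

variable {K : Type} [Field K]

/-! ## §4 (R3) CENTRING — the residue letters are heavy (the word, VERBATIM idea-2 v1.2 §4) -/

/-- **(R3) `EvenResidueLettersHeavyTwoN`** — CENTRING: along a σ_top-steered rank-one run from a normal start (p = 2, n = 4), let `i < i'` be CONSECUTIVE
point steps (no point step and no centre of height ≥ 2 strictly between: strips only) with exact even binary residue `2e` at BOTH (`1 ≤ e`). Then for
every residue datum `(g, σ, τ)` at `i` (`s i ^ 2 − g² ∈ (σ,τ)^(2e) + 𝔪ᵢ^(2e+1)`) the letters are HEAVY: `ν(σ) > ν(xᵢ)` and `ν(τ) > ν(xᵢ)` for every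
exceptional parameter `xᵢ` of the step (multiplicatively `O.valuation σ < O.valuation xᵢ`) — i.e. the exceptional letter is a LIGHT letter and the
centre of `ν` on `R (i+1)` lies on the strict transform `V(σ/xᵢ, τ/xᵢ)` of `V(σ, τ)`. The conclusion is invariant under re-lettering `σ ↦ σ + q`,
`q ∈ 𝔪ᵢ²` (`ν(q) ≥ 2ν(xᵢ) > ν(xᵢ)`). PROOF BY HAND (memo §4): by (R1) the cleaned radicand is `N = στc² + H`, `H ∈ 𝔪ᵢ^(2e+1)`; the free maximality at
`i'` (`MaxVacuity`) forces exactly `e` strips of the NEW exceptional divisor between `i` and `i'` (fewer: `xᵢ ∣` every Kunz component, not maximal;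
more, or a strip of another divisor: `N/xᵢ^(2e) ≢ □` modulo that divisor), so the radicand at `i'` is `F = N/xᵢ^(2e)` up to a square unit. If `ν(σ) =
ν(xᵢ)` (σ-chart, `τ = στ'`): `∂_{τ'} F = (c/σ^(e−1))² + σ·(…)`, of order ≤ 2(e−1) at the new centre (the first summand reduces modulo `σ` to
`C̄(1,τ')² ≠ 0`, a polynomial of degree ≤ 2e−2 in one coordinate; no cancellation with the multiple of `σ`); in characteristic 2 every derivation kills
squares, so the cleaned order of `F` is ≤ `1 + ord ∂_{τ'}F ≤ 2e − 1 < 2e` — contradiction with the residue `2e` at `i'`. Same in a τ-chart. In a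
light chart (`σ = xσ'`, `τ = xτ'`, `F = σ'τ'(c')² + x·G`) a centre OFF the line `σ' = τ' = 0` gives `ord ∂_{σ'}F` or `ord ∂_{τ'}F ≤ 2·(multiplicity of
the corresponding root of C̄) ≤ 2e − 2`, the same contradiction. Kernel size L. Why it might fail: the strip-count step if a late strip centre could be an
OLD exceptional divisor through the new centre with `F ≡ □` modulo it — excluded above since `σ'τ'(c')² ≢ □ mod (y')`, but this is the line to re-derive
first. OURS. (folklore) -/
def EvenResidueLettersHeavyTwoN : Prop :=
  ∀ p : ℕ, p = 2 →
    ∀ (k K : Type) [Field k] [CharP k p] [PerfectField k] [Field K] [Algebra k K]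
    (O : ValuationSubring K) (A₀ : Subalgebra k K) (h₀ : A₀.toSubring ≤ O.toSubring) (t : K),
    CoreDatum p 4 k K O A₀ h₀ t → ¬ HasProperCoarsening O →
    ∀ (R : ℕ → Subring K) (P : (i : ℕ) → Ideal (R i)) (s : ℕ → K),
      R 0 = locAtCentre A₀.toSubring O → NormalAt O (R 0) p t → IsSteeredRun O R P t p s →
      ∀ e i i' : ℕ, 1 ≤ e → i < i' → IsPointStep R P i → IsPointStep R P i' →
        (∀ j, i < j → j < i' → ¬ IsPointStep R P j ∧ ¬ IsPosStepTwo R P j) →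
        BinaryResiduePointStepAt R P s p (2 * e) i' →
        ∀ (_ : IsLocalRing (R i)) (hs : s i ^ p ∈ R i) (g σ τ : R i), IsRsopPart ![σ, τ] →
          (⟨s i ^ p, hs⟩ : R i) - g ^ p ∈ Ideal.span {σ, τ} ^ (2 * e) ⊔ maximalIdeal (R i) ^ (2 * e + 1) →
          (∀ h : R i, (⟨s i ^ p, hs⟩ : R i) - h ^ p ∉ maximalIdeal (R i) ^ (2 * e + 1)) →
          ∀ x : K, IsExcParamAlong O (R i) (P i) x →
            O.valuation ((σ : R i) : K) < O.valuation x ∧ O.valuation ((τ : R i) : K) < O.valuation x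

/-! ## The kernel -/

/-- Members of a steered run increase. [folklore] -/
theorem le_of_le {O : ValuationSubring K} {R : ℕ → Subring K} {P : (i : ℕ) → Ideal (R i)} {t : K} {p : ℕ} {s : ℕ → K}
    (hrun : IsSteeredRun O R P t p s) {i j : ℕ} (hij : i ≤ j) : R i ≤ R j := by
  induction hij with
  | refl => exact le_rfl
  | step _ ih =>
    obtain ⟨_, _, _, hbl, _⟩ := hrun.2 _
    exact le_trans ih hbl.isLocalBlowup.le

/-- **STRIPS FIX THE MEMBER**: between consecutive point steps `i < i'` of a steered run from a core datum, with no point step and no centre of height `≥ 2`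
strictly in between, `R i' = R (i+1)` (every intermediate step is a divisor step of a regular member: `StrippedThread.eq_locAtCentre_of_divisorStep`).
[cite: Matsumura1987, Thm. 20.3] [folklore] -/
theorem member_eq_of_strips (k K : Type) [Field k] [CharP k 2] [PerfectField k] [Field K] [Algebra k K]
    (O : ValuationSubring K) (A₀ : Subalgebra k K) (h₀ : A₀.toSubring ≤ O.toSubring) (t : K)
    (core : CoreDatum 2 4 k K O A₀ h₀ t) (R : ℕ → Subring K) (P : (i : ℕ) → Ideal (R i)) (s : ℕ → K)
    (hR0 : R 0 = locAtCentre A₀.toSubring O) (hrun : IsSteeredRun O R P t 2 s) {i i' : ℕ} (hii' : i < i')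
    (hstrip : ∀ j, i < j → j < i' → ¬ IsPointStep R P j ∧ ¬ IsPosStepTwo R P j) : R i' = R (i + 1) := by
  classical
  haveI : Fact (Nat.Prime 2) := ⟨Nat.prime_two⟩
  have hmem := NoSingularCarrier.le_and_locAtCentre_eq_of_run R P (hR0 ▸ locAtCentre_le h₀) (by rw [hR0]; exact locAtCentre_locAtCentre A₀.toSubring O)
    fun j => by obtain ⟨_, _, _, hbl, _⟩ := hrun.2 j; exact hbl
  have hstep : ∀ j, i < j → j < i' → R (j + 1) = R j := by
    intro j hij hji'
    obtain ⟨hL, hsj, hσj, hblj, -⟩ := hrun.2 j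
    haveI : IsRegularLocalRing (R j) :=
      steeredMembersRegular_holds 2 Nat.prime_two 4 le_rfl k K O A₀ h₀ t core R P s j hR0
        ⟨hrun.1, fun l _ => by obtain ⟨_, hs, -⟩ := hrun.2 l; exact hs, fun l _ => hrun.2 l⟩
    obtain ⟨hnpt, hnpos⟩ := hstrip j hij hji'
    have hne : P j ≠ maximalIdeal (R j) := fun h => hnpt ⟨hL, h⟩
    have hperm : IsPermissibleCentre (R j) 2 ⟨s j ^ 2, hsj⟩ (P j) := by
      rcases hσj with h | ⟨h, -, -⟩
      · exact h
      · exact absurd h hne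
    haveI : (P j).IsPrime := hperm.2.1.1
    have hht : (P j).height = 1 := by
      refine StrippedThread.height_eq_one_of_isLocalBlowupAlong hblj ?_
      have h2 : ¬ 2 ≤ (P j).height := fun h2 => hnpos ⟨⟨hL, hne⟩, h2⟩
      exact ENat.lt_two_iff.mp (not_le.mp h2)
    rw [StrippedThread.eq_locAtCentre_of_divisorStep (hmem j).2 hht hblj, (hmem j).2]
  -- induction along the window
  have hconst : ∀ n, i + 1 + n ≤ i' → R (i + 1 + n) = R (i + 1) := by
    intro n
    induction n with
    | zero => intro; rfl
    | succ n ih =>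
      intro hn
      rw [show i + 1 + (n + 1) = (i + 1 + n) + 1 by ring, hstep (i + 1 + n) (by omega) (by omega)]
      exact ih (by omega)
  have h := hconst (i' - i - 1) (by omega)
  rwa [show i + 1 + (i' - i - 1) = i' by omega] at h

/-- **One letter**: if `σ` has maximal value on `𝔪ᵢ` (is NOT heavy), the hypotheses of (R3) are contradictory. [folklore] -/
theorem false_of_letter_max (k K : Type) [Field k] [CharP k 2] [PerfectField k] [Field K] [Algebra k K]
    (O : ValuationSubring K) (A₀ : Subalgebra k K) (h₀ : A₀.toSubring ≤ O.toSubring) (t : K)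
    (core : CoreDatum 2 4 k K O A₀ h₀ t) (hrk : ¬ HasProperCoarsening O)
    (R : ℕ → Subring K) (P : (i : ℕ) → Ideal (R i)) (s : ℕ → K)
    (hR0 : R 0 = locAtCentre A₀.toSubring O) (hN : NormalAt O (R 0) 2 t) (hrun : IsSteeredRun O R P t 2 s)
    (e i i' : ℕ) (he : 1 ≤ e) (hii' : i < i') (hPi : IsPointStep R P i) (hPi' : IsPointStep R P i')
    (hstrip : ∀ j, i < j → j < i' → ¬ IsPointStep R P j ∧ ¬ IsPosStepTwo R P j)
    (hBR : BinaryResiduePointStepAt R P s 2 (2 * e) i')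
    (hL : IsLocalRing (R i)) (hs : s i ^ 2 ∈ R i) (g σ τ : R i) (hst : IsRsopPart ![σ, τ])
    (hres : (⟨s i ^ 2, hs⟩ : R i) - g ^ 2 ∈ Ideal.span {σ, τ} ^ (2 * e) ⊔ maximalIdeal (R i) ^ (2 * e + 1))
    (hexact : ∀ h : R i, (⟨s i ^ 2, hs⟩ : R i) - h ^ 2 ∉ maximalIdeal (R i) ^ (2 * e + 1))
    (hσmax : ∀ y : R i, y ∈ maximalIdeal (R i) → O.valuation (y : K) ≤ O.valuation ((σ : R i) : K)) : False := by
  classical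
  haveI : Fact (Nat.Prime 2) := ⟨Nat.prime_two⟩
  haveI : CharP K 2 := charP_of_injective_algebraMap (algebraMap k K).injective 2
  -- ### hygiene
  have hzd : ZeroDim k O := by obtain ⟨-, -, -, -, -, hzd, -⟩ := core; exact hzd
  have htp : t ^ 2 ∈ A₀ := by obtain ⟨-, htp, -⟩ := core; exact htp
  have hfr : IsFractionRing (Algebra.adjoin k (insert t (A₀ : Set K))) K := by obtain ⟨-, -, hfr, -⟩ := core; exact hfr
  obtain ⟨-, -, hdim, -, hirr, -⟩ := runHygieneTwo_holds 2 rfl k K O A₀ h₀ t core hrk R P s hR0 hrun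
  have hreg : ∀ j, IsRegularLocalRing (R j) := fun j =>
    steeredMembersRegular_holds 2 Nat.prime_two 4 le_rfl k K O A₀ h₀ t core R P s j hR0
      ⟨hrun.1, fun l _ => by obtain ⟨_, hs, -⟩ := hrun.2 l; exact hs, fun l _ => hrun.2 l⟩
  have hRO₀ : R 0 ≤ O.toSubring := hR0 ▸ locAtCentre_le h₀
  have hloc₀ : locAtCentre (R 0) O = R 0 := by rw [hR0]; exact locAtCentre_locAtCentre A₀.toSubring O
  have hmem := NoSingularCarrier.le_and_locAtCentre_eq_of_run R P hRO₀ hloc₀ fun j => by obtain ⟨_, _, _, hbl, _⟩ := hrun.2 j; exact hbl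
  have hN5 : ∀ j, ∀ hs : s j ^ 2 ∈ R j, ∀ π a b c : R j, Prime π → ¬ π ∣ b →
      b ^ 2 * ⟨s j ^ 2, hs⟩ = a ^ 2 + π ^ 2 * c → ∃ g₀ u₀ : R j, (⟨s j ^ 2, hs⟩ : R j) = g₀ ^ 2 + π ^ 2 * u₀ :=
    fun j hs π a b c hπ hπb heq => MaxVacuity.memberFrobeniusCongruence_two k K O A₀ h₀ t core R P s hR0 hrun j hs π a b c hπ hπb heq
  -- ### the member `R i`: a finitely generated model, perfect residue field, (R1-loc′)
  haveI := hL
  haveI := hreg i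
  obtain ⟨A₁, h₁, hA₀A₁, hRA, hfg₁, -⟩ := steeredRebase_member_of_eternal 2 Nat.prime_two 4 k K O A₀ h₀ t core R P s hR0 hrun i
  have hA : A₀.toSubring ≤ R i := fun x hx => hRA ▸ le_locAtCentre _ O (hA₀A₁ hx)
  haveI hperf : PerfectField (ResidueField (R i)) := MembersPerfectResidue.perfectField_residueField_member O A₀ R i hA (hmem i).1 hzd
  have hσm : σ ∈ maximalIdeal (R i) := by simpa using hst.mem_maximalIdeal 0
  have hτm : τ ∈ maximalIdeal (R i) := by simpa using hst.mem_maximalIdeal 1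
  have hσ0 : ((σ : R i) : K) ≠ 0 := fun h => hst.ne_zero 0 (Subtype.ext (by simpa using h))
  obtain ⟨g', c, hc, hce, hform⟩ := EvenResidueSqForm.evenResidueSqFormLocal_holds (R i) hperf ⟨s i ^ 2, hs⟩ g σ τ e he hσm hτm hres hexact
  -- ### the point step `i`: `P i = 𝔪ᵢ`, the blowup lands in `R i' = R (i+1)`
  obtain ⟨hLi, hPm⟩ := hPi
  obtain ⟨_, _, -, hbli, -⟩ := hrun.2 i
  have heq : R i' = R (i + 1) := member_eq_of_strips k K O A₀ h₀ t core R P s hR0 hrun hii' hstrip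
  have hbl : IsLocalBlowupAlong O (R i) (maximalIdeal (R i)) (R i') := by
    rw [heq, ← hPm]; exact hbli
  -- ### the member `R i'`
  obtain ⟨hLi', hs', -, -, -⟩ := hrun.2 i'
  haveI := hreg i'
  have hval' : ∀ a : R i', a ∈ maximalIdeal (R i') ↔ O.valuation (a : K) < 1 :=
    NoSingularCarrier.mem_maximalIdeal_iff_of_locAtCentre_eq (hmem i').1 (hmem i').2
  -- ### (T)+(O): the transform in the σ-chart has no deep cleaning
  obtain ⟨F, hNF, hF⟩ := EvenResidueSigmaChart.exists_transform_not_sub_sq_mem_pow O A₁ h₁ hfg₁ hRA (hreg i)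
    (hdim i) hperf (hmem i).2 (hmem i).1 hbl hst he hc hce hform hσmax
  -- ### `z := (sᵢ − g′)/σ^e` squares to `F`
  set z : K := (s i - (g' : K)) / ((σ : R i) : K) ^ e with hzdef
  have h2K : (2 : K) = 0 := CharTwo.two_eq_zero
  have hzF : z ^ 2 = (F : K) := by
    have hN : (((⟨s i ^ 2, hs⟩ : R i) - g' ^ 2 : R i) : K) = ((σ : R i) : K) ^ (2 * e) * (F : K) := hNF
    push_cast at hN
    have hσe : ((σ : R i) : K) ^ e ≠ 0 := pow_ne_zero _ hσ0
    rw [hzdef, div_pow, div_eq_iff (pow_ne_zero 2 hσe)]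
    linear_combination hN + ((g' : K) ^ 2 - s i * (g' : K)) * h2K
  have hz2 : z ^ 2 ∈ R i' := by rw [hzF]; exact F.2
  -- ### (U) at `R i'`: `z = α + β s_{i'}`
  have hgen := MaxVacuity.genAt_along_run 2 O R P t s hrun i'
  have hNi' : NormalAt O (R i') 2 (s i') :=
    MaxVacuity.normalAt_of_pointStep_along_run 2 O R P t s (n := 4) (by norm_num) hreg hdim hRO₀ hloc₀ hirr
      (fun j hs π a b c hπ hπb heq => hN5 j hs π a b c hπ hπb heq) hN hrun i' hPi'
  have hnc : ∀ g₀ u₀ π : R i', π ∈ maximalIdeal (R i') → (⟨s i' ^ 2, hs'⟩ : R i') ≠ g₀ ^ 2 + π ^ 2 * u₀ := by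
    intro g₀ u₀ π hπ hEq
    have hv : O.valuation (π : K) < 1 := (hval' π).mp hπ
    refine hNi' g₀ π u₀ g₀.2 π.2 u₀.2 hv ?_
    have := congrArg (fun r : R i' => (r : K)) hEq
    simpa using this
  have hA' : A₀.toSubring ≤ R i' := le_trans hA (le_of_le hrun hii'.le)
  have hzmem := MaxOrder.mem_closure_insert_of_sq_mem A₀ t htp hfr (R i') hA' hs' hgen.2
    (fun π a b c hπ hπb heq => hN5 i' hs' π a b c hπ hπb heq) hnc hz2
  obtain ⟨α, hα, β, hβ, hzαβ⟩ := (MaxGenDictionary.mem_closure_insert_iff_of_sq_mem (R i') hs' z).mp hzmem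
  -- ### the cleaning at `i'`
  obtain ⟨-, hLi'', hs'', g₂, σ₂, τ₂, hrs₂, hmem₂, -⟩ := hBR
  have hm₂ : (⟨s i' ^ 2, hs''⟩ : R i') - g₂ ^ 2 ∈ maximalIdeal (R i') ^ (2 * e) := by
    have hle : Ideal.span {σ₂, τ₂} ^ (2 * e) ⊔ maximalIdeal (R i') ^ (2 * e + 1) ≤ maximalIdeal (R i') ^ (2 * e) := by
      refine sup_le (Ideal.pow_right_mono ?_ _) (Ideal.pow_le_pow_right (by omega))
      rw [Ideal.span_le]
      rintro a (rfl | rfl)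
      · simpa using hrs₂.mem_maximalIdeal 0
      · simpa using hrs₂.mem_maximalIdeal 1
    exact hle hmem₂
  -- ### `F − (α + β g₂)² = β² (s_{i'}² − g₂²) ∈ 𝔪^(2e)`: contradiction
  apply hF (⟨α, hα⟩ + ⟨β, hβ⟩ * g₂)
  have hkey : F - (⟨α, hα⟩ + ⟨β, hβ⟩ * g₂) ^ 2 = ⟨β, hβ⟩ ^ 2 * ((⟨s i' ^ 2, hs''⟩ : R i') - g₂ ^ 2) := by
    apply Subtype.ext
    push_cast
    rw [← hzF, hzαβ]
    linear_combination (α * β * (s i' - ((g₂ : R i') : K))) * h2K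
  rw [hkey]
  exact Ideal.mul_mem_left _ _ hm₂

/-- **(R3) `EvenResidueLettersHeavyTwoN` HOLDS.** OURS. [folklore] -/
theorem evenResidueLettersHeavyTwoN_holds : EvenResidueLettersHeavyTwoN := by
  intro p hp2 k K _ _ _ _ _ O A₀ h₀ t core hrk R P s hR0 hN hrun e i i' he hii' hPi hPi' hstrip hBR hL hs g σ τ hst hres hexact x hx
  subst hp2
  obtain ⟨⟨hxR, hxP⟩, hx0, hxmax⟩ := hx
  have hPm : P i = @maximalIdeal (R i) _ hL := by obtain ⟨_, h⟩ := hPi; exact h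
  have hmax : ∀ y : R i, y ∈ @maximalIdeal (R i) _ hL → O.valuation (y : K) ≤ O.valuation x := fun y hy => hxmax y (hPm ▸ hy)
  constructor
  · by_contra hσ
    rw [not_lt] at hσ
    exact false_of_letter_max k K O A₀ h₀ t core hrk R P s hR0 hN hrun e i i' he hii' hPi hPi' hstrip hBR hL hs g σ τ hst hres hexact
      (fun y hy => le_trans (hmax y hy) hσ)
  · by_contra hτ
    rw [not_lt] at hτ
    have hst' : IsRsopPart ![τ, σ] := by
      have h := hst.comp_equiv (Equiv.swap 0 1)
      convert h using 1
      ext j; fin_cases j <;> rfl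
    refine false_of_letter_max k K O A₀ h₀ t core hrk R P s hR0 hN hrun e i i' he hii' hPi hPi' hstrip hBR hL hs g τ σ hst' ?_ hexact
      (fun y hy => le_trans (hmax y hy) hτ)
    rw [Set.pair_comm]
    exact hres

end Summit.ResolutionOfSingularities.ResolutionOfSingularities.Theorems.SwitchingDichotomy.HevLeaf.EvenResidueLettersHeavy

end
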